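import Literature.NumberTheory.Automorphic.Liu2021.Def411WeilCarriersIrreducibleOrZeroAtLine
import Literature.NumberTheory.Automorphic.Liu2021.Def411WeilCarriersIrreducibleOfLocal
import HarnessLib

/-!
# [Liu2021, Def. 4.11]'s carrier at a line `⟨a⟩` is IRREDUCIBLE OR ZERO for EVERY continuous unitary character of the line's unitary
# group — the CHARACTER-GENERIC twin of `Def411WeilCarriersIrreducibleOrZeroAtLine` §4 (not only the automorphic `χ ∈ Chi`)

Topic `NumberTheory/Automorphic/Liu2021`; namespaces `Literature.NumberTheory.GelbartRogawski1991.UnitaryDualPair.WeilCoinv` (§1, the transport) and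
`Literature.NumberTheory.Automorphic.Liu2021.Def411WeilCarriers` (§2–§3, the heads).  KERNEL ONLY: theorems, no definition, no named fact, no `sorry`.

WHY (cell `hodgecm-mathlib`, crux `hLiu418` = stmt-HodgeConjecture-24832, line LD1, organ (Gα) `ThetaDichotomy₂`, brick (Gα-Cf) `FinGeneration` of
LD1-plan's `F0LD1ThetaDichotomyOfBricks`, DEALS #9 (b)): the theta road reads the theta lift `Θ̃_Ψ(ξ)` at EVERY continuous unitary character `ξ` of
`[U(⟨a⟩)]`; the character of `U(⟨a⟩)(𝔸_{L⁺,f})` through which the finite Schwartz–Bruhat factor acts, `u ↦ ξ([u])`, is continuous and unitary but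
NOT trivial on `E¹` in general — not a `Chi`.  The ★ head `isIrreducibleOrZero_rhoVAtLine_chiSplittingLine` is typed over `χ : Chi` through the
`rhoVAtLine` carrier; its proof uses only the continuity and unitarity of `χ`.  As for admissibility (★ `Def411WeilCarriersAdmissibleAtLine` ED. 2),
the twin is stated on the bare `χ′`-coinvariants ★ `WeilCoinv.weilCoinv … χ′ (isCompatible_chiSplittingLine …)`:

* §1 `isIrreducibleOrZero_weilCoinv_of_omega_center` — the «irreducible OR ZERO» twin of ★ `isAdmissible_weilCoinv_of_omega_center` ∕ (one direction
  of) ★ `isIrreducible_weilCoinv_iff_omega_center`: for a line `W`, a compatible splitting `s` FACTORING through the local reference section of `𝓢`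
  (`hfac`, no twist) and ANY character `χ′` of `U(J_W)(𝔸_f)`, `IsIrreducibleOrZero` passes from «the maximal quotient of `Ω` on which the CENTRE
  acts by `χ₁ = χ′ ∘ (u ↦ u·1_W)`» to `Ω(s, χ′) = weilCoinv χ′ hs` — the same three equivariant linear equivalences (★ `exists_weilCoinv_equiv_reference`,
  twist `1`; ★ `TwistedCoinv.mapEquiv` along `R_e = finSBReindex F e`, ★ `finRepMp_localRefSection_apply`; same relation submodule for the centre acting
  through `u ↦ u·1_W`, ★ `TwistedCoinv.ker_comp_of_surjective`), each read through ★ `isIrreducibleOrZero_iff_of_twist_equivariant`.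
* §2 HEAD `isIrreducibleOrZero_weilCoinv_chiSplittingLine_of_continuous` — for a CM field `L`, ANY rank `N'` with `2 ≤ n'`, real diagonal `dV₁`, THE
  χ-attached splitting `chiSplittingLine θ` of a unitary splitting character `θ`, any line `⟨a⟩` and EVERY continuous unitary character `χ′` of
  `U(⟨a⟩)(𝔸_{L⁺,f})`: `IsIrreducibleOrZero (weilCoinv (Fp L) L c̄ N' 1 e₁ (diagonal dV₁) (JW a) … χ′ (isCompatible_chiSplittingLine …))` — binders
  VERBATIM those of ★ `isAdmissible_weilCoinv_chiSplittingLine_of_continuous`; via the twist-free factorisation ★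
  `GRConstruction.pairSmall₁_chiSplittingLine_finPairToAdelic_eq_localRefSection`, §1 at `𝓢_θ = congrW … (undoubledSplittings … (cmFinLocalFamily …))`,
  ★ `WeilCoinv.omega_center_isIrreducibleOrZero_of_local` with the local inputs ★ `isIrreducibleOrZero_and_isAdmissible_local … hn'` under the unitarity
  ★ `isL2Isometric_omegaLoc_congrW_undoubledSplittings_cmFinLocalFamily`, survival ★ `FinLocalSplittings.exists_finset_mk_unitVec_ne_zero`.
* §3 `…_comp_of_surjective` — the same through any SURJECTIVE change of group (★ `isIrreducibleOrZero_comp_iff_of_surjective`).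

HC_CM is proved only modulo the 7 printed citations (`hDel`, `h21`, `hLiu418`, `h411`, `h413`, `hD3`, `hD1''`) until rung 0 closes; this file
discharges none of them and no interface fact (a `--supports` helper).

## References
* [Liu2021] Y. Liu, *Fourier–Jacobi cycles and arithmetic relative trace formula*, Camb. J. Math. 9 (2021) = arXiv:2102.11518: Def. 4.11
  (l. 2090–2096), App. D §D.1 Steps 1–3 (l. 5217–5221), Lem. D.1 first sentence + (1) (l. 5226–5229).
* [GelbartRogawski1991] S. Gelbart, J. Rogawski, Invent. Math. 105 (1991), §3.1 Prop. 3.1.1 p. 455, Remark p. 457 L4–13.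
* [MoeglinVignerasWaldspurger1987] C. Mœglin, M.-F. Vignéras, J.-L. Waldspurger, LNM 1291, Chap. 3 IV.4 Thm principal 1a), 2a).
* [Flath1979] D. Flath, PSPM 33 (1979) part 1, §2, Theorem 2 ∕ Example 2.
* [Bump1997] D. Bump, *Automorphic forms and representations* (1997), §4.2 (twisting by a character).
-/

set_option autoImplicit false

noncomputable section

open scoped Matrix Kronecker TensorProduct Classical RestrictedProduct
open NumberField NumberField.mixedEmbedding IsDedekindDomain Filter Set
open _root_.MeasureTheory
open Literature.NumberTheory Literature.NumberTheory.Automorphic Literature.NumberTheory.Automorphic.UnitaryGroup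
open Literature.NumberTheory.GelbartRogawski1991 Literature.NumberTheory.GelbartRogawski1991.UnitaryDualPair
open Literature.NumberTheory.GelbartRogawski1991.UnitaryDualPair.WeilCoinv
open Literature.NumberTheory.GelbartRogawski1991.GRConstruction
open Literature.NumberTheory.Weil1964 Literature.RepresentationTheory
open Literature.RepresentationTheory.HeisenbergGroup
open Literature.GroupTheory.RestrictedProductCharacter
open Literature.RepresentationTheory.MoeglinVignerasWaldspurger1987
open Literature.NumberTheory.GaloisRepresentations Literature.RepresentationTheory.HarrisKudlaSweet1996
open Literature.NumberTheory.Automorphic.Liu2021 Literature.NumberTheory.Automorphic.Liu2021.Def411WeilCarriersDoubling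

/-! ## §1 «Irreducible or zero» transported from the central quotient of the place-assembled `Ω` to `Ω(s, χ′)` (line `W`, any `χ′`) -/

namespace Literature.NumberTheory.GelbartRogawski1991.UnitaryDualPair.WeilCoinv

variable (F E : Type) [Field F] [NumberField F] [Field E] [NumberField E] [Algebra F E]
variable (c : E ≃ₐ[F] E) (N : ℕ) {n : ℕ} (e : Fin N × Fin 1 ≃ Fin n)
variable (JV : Matrix (Fin N) (Fin N) E) (JW : Matrix (Fin 1) (Fin 1) E)
variable {TV : Matrix (Fin N) (Fin N) F} {TW : Matrix (Fin 1) (Fin 1) F}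
variable [Algebra.IsQuadraticExtension F E] {δ : E} (hcδ : c δ = -δ) (hδ : δ ≠ 0) {d : F}
  (hd : δ * δ = algebraMap F E d) (hV : TV.IsSymm) (hW : TW.IsSymm) (hVd : IsUnit TV.det) (hWd : IsUnit TW.det)
  (hJV : JV = TV.map (algebraMap F E)) (hJW : JW = TW.map (algebraMap F E)) (hJW0 : JW 0 0 ≠ 0)
  (𝓢 : LocalSplitting.FinLocalSplittings F E c n hcδ hδ hd (gram F e TV TW) (isSymm_gram F e hV hW)
    (reindex_kronecker_eq_gram_map F E e hJV hJW))

variable {s : UnitaryGroup.adelicPair F E c N 1 JV JW →* adelicMpCont F (Fin n) (adelicGram F e TV TW)}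
  (hs : (splittingDatum F E c N 1 e JV JW hcδ hδ hd hV hW hVd hWd hJV hJW).IsCompatible s)

include hJW0 in
set_option maxHeartbeats 800000 in -- as ★ `isAdmissible_weilCoinv_of_omega_center`: three transports inside the pair telescope
/-- **`Ω(s, χ′)` is IRREDUCIBLE OR ZERO once the `U(J_V)(𝔸_f)`-action on «the maximal quotient of `Ω` on which the CENTRE `E¹(𝔸_{F,f})` acts by
`χ₁ = χ′ ∘ (u ↦ u·1_W)`» is** — line `W`, compatible splitting `s` FACTORING through the local reference section of `𝓢` (`hfac`, no twist), ANY
character `χ′` of `U(J_W)(𝔸_f)`; the «irreducible or zero» twin of ★ `isAdmissible_weilCoinv_of_omega_center` (same three equivariant equivalences,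
read through ★ `isIrreducibleOrZero_iff_of_twist_equivariant`): `Ω(s, χ′) ≃ Coinv(ω_f^{s₀}|_{U(J_W)}, χ′)` (★ `exists_weilCoinv_equiv_reference`, twist `1`)
`≃` the `χ′`-coinvariants of `u ↦ Ω(reindex (1 ⊗ u))` along `R_e = finSBReindex F e` (★ `TwistedCoinv.mapEquiv`), whose relation submodule is that of the
centre acting through `Ω ∘ finAdelicCenter` (★ `finPairEmb_one_finAdelicCenter`, ★ `finAdelicCenter_surjective_one`, ★ `TwistedCoinv.ker_comp_of_surjective`).
[cite: Liu2021, Def. 4.11 (l. 2092–2096), App. D §D.1 Step 3 (l. 5221), Lemma D.1 (1) (l. 5229)] [cite: GelbartRogawski1991, §3.1 Prop. 3.1.1 p. 455 L1–3, Remark p. 457 L4–13]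
[cite: Bump1997, §4.2] -/
theorem isIrreducibleOrZero_weilCoinv_of_omega_center
    (hfac : (pairSmall₁ F E c N 1 e JV JW s).comp (finPairToAdelic F E c N 1 JV JW) =
      localRefSection F E c N 1 e JV JW hcδ hδ hd hV hW hJV hJW 𝓢)
    (χ' : UnitaryGroup.finAdelic F E c 1 JW →* ℂˣ) {χ₁ : finAdelicOne F E c →* ℂˣ}
    (hχ₁ : χ'.comp (UnitaryGroup.finAdelicCenter F E c 1 JW) = χ₁)
    (h : IsIrreducibleOrZero (TwistedCoinv.rep χ₁
      (show Representation ℂ (finAdelic F E c N JV) _ from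
        𝓢.Omega.comp ((finPairEmb F E c N 1 e JV JW).comp (MonoidHom.inl _ _)))
      (commute_omega_finPairEmb_finAdelicCenter F E c N e JV JW hcδ hδ hd hV hW hJV hJW 𝓢))) :
    IsIrreducibleOrZero (weilCoinv F E c N 1 e JV JW hcδ hδ hd hV hW hVd hWd hJV hJW χ' hs) := by
  subst hχ₁
  -- the twist against the local reference section is `1`
  have hχ : (pairSmall₁ F E c N 1 e JV JW s).comp (finPairToAdelic F E c N 1 JV JW) =
      adelicMpCont.twist F (Fin N × Fin 1) _ (localRefSection F E c N 1 e JV JW hcδ hδ hd hV hW hJV hJW 𝓢)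
        (1 : UnitaryGroup.finAdelic F E c N JV × UnitaryGroup.finAdelic F E c 1 JW →* ℂˣ) :=
    hfac.trans (MonoidHom.ext fun h => (adelicMpCont.twist_eq_of_eq_one _ (1 : _ →* ℂˣ) rfl).symm)
  have hχ' : ∀ u, χ' u = (1 : UnitaryGroup.finAdelic F E c N JV × UnitaryGroup.finAdelic F E c 1 JW →* ℂˣ) (1, u) * χ' u :=
    fun u => by rw [MonoidHom.one_apply, one_mul]
  -- (E3) pull the acting group back along the surjection `u ↦ u·1_W : E¹(𝔸_f) ↠ U(J_W)(𝔸_f)`: same relation submodule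
  have hWrep : (show Representation ℂ (UnitaryGroup.finAdelicOne F E c) _ from
      (show Representation ℂ (UnitaryGroup.finAdelic F E c 1 JW) _ from
        𝓢.Omega.comp ((finPairEmb F E c N 1 e JV JW).comp (MonoidHom.inr _ _))).comp
          (UnitaryGroup.finAdelicCenter F E c 1 JW)) =
      (show Representation ℂ (UnitaryGroup.finAdelicOne F E c) _ from
        𝓢.Omega.comp (UnitaryGroup.finAdelicCenter F E c n (Matrix.reindex e e (JV ⊗ₖ JW)))) := by
    refine MonoidHom.ext fun u => ?_
    change 𝓢.Omega (finPairEmb F E c N 1 e JV JW (1, UnitaryGroup.finAdelicCenter F E c 1 JW u)) =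
      𝓢.Omega (UnitaryGroup.finAdelicCenter F E c n (Matrix.reindex e e (JV ⊗ₖ JW)) u)
    rw [finPairEmb_one_finAdelicCenter]
  have hker : TwistedCoinv.ker (show Representation ℂ (UnitaryGroup.finAdelicOne F E c) _ from
        𝓢.Omega.comp (UnitaryGroup.finAdelicCenter F E c n (Matrix.reindex e e (JV ⊗ₖ JW))))
        (χ'.comp (UnitaryGroup.finAdelicCenter F E c 1 JW)) =
      TwistedCoinv.ker (show Representation ℂ (UnitaryGroup.finAdelic F E c 1 JW) _ from
        𝓢.Omega.comp ((finPairEmb F E c N 1 e JV JW).comp (MonoidHom.inr _ _))) χ' := by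
    rw [← hWrep]
    exact TwistedCoinv.ker_comp_of_surjective _ χ' (UnitaryGroup.finAdelicCenter F E c 1 JW)
      (UnitaryGroup.finAdelicCenter_surjective_one F E c JW hJW0)
  have h3 : IsIrreducibleOrZero (TwistedCoinv.rep χ'
      (show Representation ℂ (UnitaryGroup.finAdelic F E c N JV) _ from
        𝓢.Omega.comp ((finPairEmb F E c N 1 e JV JW).comp (MonoidHom.inl _ _)))
      (commute_omega_finPairEmb F E c N 1 e JV JW hcδ hδ hd hV hW hJV hJW 𝓢)) := by
    refine (isIrreducibleOrZero_iff_of_twist_equivariant _ _ (Submodule.quotEquivOfEq _ _ hker) 1 fun k x => ?_).1 h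
    obtain ⟨v, rfl⟩ := TwistedCoinv.mk_surjective _ _ x
    rw [MonoidHom.one_apply, Units.val_one, one_smul]
    rfl
  -- (E2) transport along `R_e = finSBReindex F e` to the reference section `s₀ = localRefSection 𝓢`
  have hT1 : ∀ (u : UnitaryGroup.finAdelic F E c 1 JW) (f : FinSB F (Fin N × Fin 1)),
      (show Representation ℂ (UnitaryGroup.finAdelic F E c 1 JW) _ from
          𝓢.Omega.comp ((finPairEmb F E c N 1 e JV JW).comp (MonoidHom.inr _ _))) u (finSBReindex F e f) =
        (((fun _ => (1 : ℂˣ)) u : ℂˣ) : ℂ) •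
          finSBReindex F e (((finRepMp (isUnit_kronecker_map F N hVd hWd) (localRefSection F E c N 1 e JV JW hcδ hδ hd hV hW hJV hJW 𝓢)
            (harch_localRefSection F E c N 1 e JV JW hcδ hδ hd hV hW hVd hWd hJV hJW 𝓢 hs)).comp (MonoidHom.inr _ _)) u f) := fun u f => by
    rw [Units.val_one, one_smul]
    change 𝓢.Omega (finPairEmb F E c N 1 e JV JW (1, u)) (finSBReindex F e f) =
      finSBReindex F e (finRepMp (isUnit_kronecker_map F N hVd hWd) (localRefSection F E c N 1 e JV JW hcδ hδ hd hV hW hJV hJW 𝓢)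
        (harch_localRefSection F E c N 1 e JV JW hcδ hδ hd hV hW hVd hWd hJV hJW 𝓢 hs) (1, u) f)
    rw [finRepMp_localRefSection_apply F E c N 1 e JV JW hcδ hδ hd hV hW hVd hWd hJV hJW 𝓢 hs, LinearEquiv.apply_symm_apply]
  have hg : ∀ (k : UnitaryGroup.finAdelic F E c N JV) (f : FinSB F (Fin N × Fin 1)),
      (show Representation ℂ (UnitaryGroup.finAdelic F E c N JV) _ from
          𝓢.Omega.comp ((finPairEmb F E c N 1 e JV JW).comp (MonoidHom.inl _ _))) k (finSBReindex F e f) =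
        (1 : ℂ) • finSBReindex F e (((finRepMp (isUnit_kronecker_map F N hVd hWd) (localRefSection F E c N 1 e JV JW hcδ hδ hd hV hW hJV hJW 𝓢)
          (harch_localRefSection F E c N 1 e JV JW hcδ hδ hd hV hW hVd hWd hJV hJW 𝓢 hs)).comp (MonoidHom.inl _ _)) k f) := fun k f => by
    rw [one_smul]
    change 𝓢.Omega (finPairEmb F E c N 1 e JV JW (k, 1)) (finSBReindex F e f) =
      finSBReindex F e (finRepMp (isUnit_kronecker_map F N hVd hWd) (localRefSection F E c N 1 e JV JW hcδ hδ hd hV hW hJV hJW 𝓢)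
        (harch_localRefSection F E c N 1 e JV JW hcδ hδ hd hV hW hVd hWd hJV hJW 𝓢 hs) (k, 1) f)
    rw [finRepMp_localRefSection_apply F E c N 1 e JV JW hcδ hδ hd hV hW hVd hWd hJV hJW 𝓢 hs, LinearEquiv.apply_symm_apply]
  have h2 : IsIrreducibleOrZero (TwistedCoinv.rep χ'
      ((finRepMp (isUnit_kronecker_map F N hVd hWd) (localRefSection F E c N 1 e JV JW hcδ hδ hd hV hW hJV hJW 𝓢)
        (harch_localRefSection F E c N 1 e JV JW hcδ hδ hd hV hW hVd hWd hJV hJW 𝓢 hs)).comp (MonoidHom.inl _ _))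
      (commute_comp_inl_comp_inr _)) := by
    refine (isIrreducibleOrZero_iff_of_twist_equivariant _ _
      (TwistedCoinv.mapEquiv _ χ' _ χ' (finSBReindex F e) (fun _ => 1) hT1 (fun u => (one_mul _).symm)) 1 fun k x => ?_).2 h3
    rw [MonoidHom.one_apply, Units.val_one, one_smul,
      TwistedCoinv.mapEquiv_rep _ χ' _ χ' _ _ (commute_comp_inl_comp_inr _)
        (commute_omega_finPairEmb F E c N 1 e JV JW hcδ hδ hd hV hW hJV hJW 𝓢) (finSBReindex F e) (fun _ => 1) hT1
        (fun u => (one_mul _).symm) (hg k) x, one_smul]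
  -- (E1) `Ω(s, χ′) ≃ Coinv(ω_f^{s₀}|_{U(J_W)}, χ′)`, equivariant (twist `1`)
  obtain ⟨T, -, hT⟩ := exists_weilCoinv_equiv_reference F E c N 1 e JV JW hcδ hδ hd hV hW hVd hWd hJV hJW
    (proj_localRefSection_eq F E c N 1 e JV JW hcδ hδ hd hV hW hVd hWd hJV hJW 𝓢 hs) hχ hs hχ'
  exact (isIrreducibleOrZero_iff_of_twist_equivariant (weilCoinv F E c N 1 e JV JW hcδ hδ hd hV hW hVd hWd hJV hJW χ' hs)
    (TwistedCoinv.rep χ'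
      ((finRepMp (isUnit_kronecker_map F N hVd hWd) (localRefSection F E c N 1 e JV JW hcδ hδ hd hV hW hJV hJW 𝓢)
        (harch_localRefSection F E c N 1 e JV JW hcδ hδ hd hV hW hVd hWd hJV hJW 𝓢 hs)).comp (MonoidHom.inl _ _))
      (commute_comp_inl_comp_inr _)) T 1 fun k x => by
    simpa only [MonoidHom.one_apply, Units.val_one, one_smul] using hT k x).2 h2

end Literature.NumberTheory.GelbartRogawski1991.UnitaryDualPair.WeilCoinv

/-! ## §2 HEAD: `ω(μ, ε, ·)` at THE χ-attached splitting is IRREDUCIBLE OR ZERO for every continuous unitary character, every rank `n ≥ 2` -/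

namespace Literature.NumberTheory.Automorphic.Liu2021.Def411WeilCarriers

section HeadGeneric

variable (L : Type) [Field L] [NumberField L] [IsCMField L]
variable {N' n' : ℕ} (e₁ : Fin N' × Fin 1 ≃ Fin n') (hn' : 2 ≤ n')
  (dV₁ : Fin N' → L) (hdV₁ : ∀ i, IsCMField.complexConj L (dV₁ i) = dV₁ i) (hdV₁0 : ∀ i, dV₁ i ≠ 0)
  (θ : HeckeCharacter L) (hθu : θ.IsUnitary) (hθs : IsSplittingChar L 1 θ)
  (a : (Fp L)ˣ)

include hn' in
/-- **[Liu2021, Def. 4.11]'s carrier AT THE χ-ATTACHED SPLITTING `chiSplittingLine θ` IS IRREDUCIBLE OR ZERO FOR EVERY CONTINUOUS UNITARY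
CHARACTER `χ′` OF `U(⟨a⟩)(𝔸_{L⁺,f})`**, every rank `n ≥ 2` (★ `WeilCoinv.weilCoinv … χ′ (isCompatible_chiSplittingLine …)`; at `χ′ := lineChar a χ.1`,
`χ ∈ Chi`, this is ★ `isIrreducibleOrZero_rhoVAtLine_chiSplittingLine`).  PROOF: the χ-splitting read on the finite-adelic pair IS the reference section of
the transported local undoublings `𝓢_θ = congrW … (undoubledSplittings … (cmFinLocalFamily …))` (★
`GRConstruction.pairSmall₁_chiSplittingLine_finPairToAdelic_eq_localRefSection`, no twist), so §1 reduces to ★ `WeilCoinv.omega_center_isIrreducibleOrZero_of_local`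
at `𝓢_θ` and the bare character `χ₁ := χ′ ∘ (u ↦ u·1_W)` (continuous ★ `UnitaryGroup.continuous_finAdelicCenter`, unitary), whose local inputs are ★
`isIrreducibleOrZero_and_isAdmissible_local … hn'` under the unitarity ★ `isL2Isometric_omegaLoc_congrW_undoubledSplittings_cmFinLocalFamily` and whose
survival clause is ★ `FinLocalSplittings.exists_finset_mk_unitVec_ne_zero`.  At `N' = 2` ZERO does occur ([Liu2021, App. D Lem. D.1 (1)]).
[cite: Liu2021, Def. 4.11 (l. 2090–2096), App. D §D.1 Steps 1∕2∕3 (l. 5217∕5219∕5221), Lemma D.1 (l. 5227; (1) l. 5229)]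
[cite: GelbartRogawski1991, §3.1 Prop. 3.1.1 p. 455, Remark p. 457 L4–13] [cite: Flath1979, Theorem 2 / Example 2] -/
theorem isIrreducibleOrZero_weilCoinv_chiSplittingLine_of_continuous
    (χ' : UnitaryGroup.finAdelic (Fp L) L (IsCMField.complexConj L) 1 (JW (Fp L) L a) →* ℂˣ)
    (hχ'n : ∀ g, ‖((χ' g : ℂˣ) : ℂ)‖ = 1) (hχ'c : Continuous χ') :
    IsIrreducibleOrZero
      (weilCoinv (Fp L) L (IsCMField.complexConj L) N' 1 e₁ (Matrix.diagonal dV₁) (JW (Fp L) L a) (complexConj_imagUnit L)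
        (imagUnit_ne_zero L) (imagUnit_mul_self L) (realDiagonal_isSymm L dV₁ hdV₁) (isSymm_TW (Fp L) a)
        (isUnit_det_realDiagonal L dV₁ hdV₁ hdV₁0) (isUnit_det_TW (Fp L) a) (realDiagonal_map L dV₁ hdV₁).symm (JW_eq (Fp L) L a)
        χ'
        (isCompatible_chiSplittingLine L e₁ dV₁ hdV₁ hdV₁0 θ hθu hθs (TW (Fp L) a) (isSymm_TW (Fp L) a)
          (isUnit_det_TW (Fp L) a) (JW (Fp L) L a) (JW_eq (Fp L) L a))) := by
  haveI : NeZero n' := ⟨by omega⟩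
  have hχ₁c : Continuous (χ'.comp (UnitaryGroup.finAdelicCenter (Fp L) L (IsCMField.complexConj L) 1 (JW (Fp L) L a))) :=
    hχ'c.comp (UnitaryGroup.continuous_finAdelicCenter (Fp L) L (IsCMField.complexConj L) 1 (JW (Fp L) L a))
  refine isIrreducibleOrZero_weilCoinv_of_omega_center (Fp L) L (IsCMField.complexConj L) N' e₁ (Matrix.diagonal dV₁) (JW (Fp L) L a)
    (complexConj_imagUnit L) (imagUnit_ne_zero L) (imagUnit_mul_self L) (realDiagonal_isSymm L dV₁ hdV₁) (isSymm_TW (Fp L) a)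
    (isUnit_det_realDiagonal L dV₁ hdV₁ hdV₁0) (isUnit_det_TW (Fp L) a) (realDiagonal_map L dV₁ hdV₁).symm (JW_eq (Fp L) L a)
    (JW_apply_ne_zero (Fp L) L a) _
    (isCompatible_chiSplittingLine L e₁ dV₁ hdV₁ hdV₁0 θ hθu hθs (TW (Fp L) a) (isSymm_TW (Fp L) a)
      (isUnit_det_TW (Fp L) a) (JW (Fp L) L a) (JW_eq (Fp L) L a))
    (GRConstruction.pairSmall₁_chiSplittingLine_finPairToAdelic_eq_localRefSection L θ hθu hθs e₁ dV₁ hdV₁ hdV₁0 (TW (Fp L) a)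
      (isSymm_TW (Fp L) a) (isUnit_det_TW (Fp L) a) (JW (Fp L) L a) (JW_eq (Fp L) L a) (borelPlaceMeasure L)
      (cmFinLocalFamily L e₁ dV₁ hdV₁ hdV₁0 (lineW L (TW (Fp L) a)) (complexConj_lineW L (TW (Fp L) a))
        (lineW_ne_zero L (TW (Fp L) a) (isUnit_det_TW (Fp L) a)) θ hθs (borelPlaceMeasure L)))
    χ' rfl ?_
  -- the local inputs at `𝓢_θ`, place by place
  have hloc := fun v : HeightOneSpectrum (𝓞 (Fp L)) => by
    letI := (borelPlaceMeasure L v).mS; haveI := (borelPlaceMeasure L v).isBorel; haveI := (borelPlaceMeasure L v).isHaar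
    exact isIrreducibleOrZero_and_isAdmissible_local (Fp L) L (IsCMField.complexConj L) N' e₁ (Matrix.diagonal dV₁)
      (complexConj_imagUnit L) (imagUnit_ne_zero L) (imagUnit_mul_self L) (realDiagonal_isSymm L dV₁ hdV₁)
      (isUnit_det_realDiagonal L dV₁ hdV₁ hdV₁0) (realDiagonal_map L dV₁ hdV₁).symm a
      (congrW L e₁ dV₁ hdV₁ (lineW L (TW (Fp L) a)) (complexConj_lineW L (TW (Fp L) a)) (realDiagonal_lineW L (TW (Fp L) a))
        (diagonal_lineW L (TW (Fp L) a) (JW_eq (Fp L) L a))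
        (undoubledSplittings L e₁ dV₁ hdV₁ hdV₁0 (lineW L (TW (Fp L) a)) (complexConj_lineW L (TW (Fp L) a))
          (lineW_ne_zero L (TW (Fp L) a) (isUnit_det_TW (Fp L) a)) θ (borelPlaceMeasure L)
          (cmFinLocalFamily L e₁ dV₁ hdV₁ hdV₁0 (lineW L (TW (Fp L) a)) (complexConj_lineW L (TW (Fp L) a))
            (lineW_ne_zero L (TW (Fp L) a) (isUnit_det_TW (Fp L) a)) θ hθs (borelPlaceMeasure L)))
        (isSymm_TW (Fp L) a) (JW_eq (Fp L) L a))
      _ (fun u => hχ'n _) hχ₁c v hn' (borelPlaceMeasure L v).μ fun _ =>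
        isL2Isometric_omegaLoc_congrW_undoubledSplittings_cmFinLocalFamily L e₁ dV₁ hdV₁ hdV₁0 (lineW L (TW (Fp L) a))
          (complexConj_lineW L (TW (Fp L) a)) (lineW_ne_zero L (TW (Fp L) a) (isUnit_det_TW (Fp L) a)) θ hθs
          (borelPlaceMeasure L) v hθu (realDiagonal_lineW L (TW (Fp L) a)) (diagonal_lineW L (TW (Fp L) a) (JW_eq (Fp L) L a))
          (isSymm_TW (Fp L) a) (JW_eq (Fp L) L a) (borelPlaceMeasure L v).μ
  -- the survival clause of Def. 4.11's `⊗'` (continuity of `χ₁` only)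
  obtain ⟨S₁, hS₁⟩ := (congrW L e₁ dV₁ hdV₁ (lineW L (TW (Fp L) a)) (complexConj_lineW L (TW (Fp L) a)) (realDiagonal_lineW L (TW (Fp L) a))
        (diagonal_lineW L (TW (Fp L) a) (JW_eq (Fp L) L a))
        (undoubledSplittings L e₁ dV₁ hdV₁ hdV₁0 (lineW L (TW (Fp L) a)) (complexConj_lineW L (TW (Fp L) a))
          (lineW_ne_zero L (TW (Fp L) a) (isUnit_det_TW (Fp L) a)) θ (borelPlaceMeasure L)
          (cmFinLocalFamily L e₁ dV₁ hdV₁ hdV₁0 (lineW L (TW (Fp L) a)) (complexConj_lineW L (TW (Fp L) a))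
            (lineW_ne_zero L (TW (Fp L) a) (isUnit_det_TW (Fp L) a)) θ hθs (borelPlaceMeasure L)))
        (isSymm_TW (Fp L) a) (JW_eq (Fp L) L a)).exists_finset_mk_unitVec_ne_zero
    (JW (Fp L) L a) (JW_apply_ne_zero (Fp L) L a)
    (isUnit_det_gram (Fp L) e₁ (isUnit_det_realDiagonal L dV₁ hdV₁ hdV₁0) (isUnit_det_TW (Fp L) a)) (JW_map_transpose (Fp L) L (IsCMField.complexConj L) a) hχ₁c
  exact omega_center_isIrreducibleOrZero_of_local (Fp L) L (IsCMField.complexConj L) N' e₁ (Matrix.diagonal dV₁) (JW (Fp L) L a)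
    (complexConj_imagUnit L) (imagUnit_ne_zero L) (imagUnit_mul_self L) (realDiagonal_isSymm L dV₁ hdV₁) (isSymm_TW (Fp L) a)
    (realDiagonal_map L dV₁ hdV₁).symm (JW_eq (Fp L) L a) (JW_apply_ne_zero (Fp L) L a) _ hχ₁c hS₁
    (fun v => (hloc v).1) (fun v => (hloc v).2)

/-! ## §3 The same through any SURJECTIVE change of group -/

include hn' in
/-- **… through any SURJECTIVE change of group** `ι : G →* U(diag dV₁)(𝔸_{L⁺,f})` (e.g. a rational frame isomorphism of one of the cell's lines):
`IsIrreducibleOrZero ((weilCoinv … χ′ (isCompatible_chiSplittingLine …)).comp ι)` (★ `isIrreducibleOrZero_comp_iff_of_surjective`).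
[cite: Liu2021, Def. 4.11 (l. 2090–2096), App. D Lemma D.1 (l. 5227; (1) l. 5229)] -/
theorem isIrreducibleOrZero_weilCoinv_chiSplittingLine_of_continuous_comp_of_surjective
    (χ' : UnitaryGroup.finAdelic (Fp L) L (IsCMField.complexConj L) 1 (JW (Fp L) L a) →* ℂˣ)
    (hχ'n : ∀ g, ‖((χ' g : ℂˣ) : ℂ)‖ = 1) (hχ'c : Continuous χ') {G : Type} [Group G]
    (ι : G →* UnitaryGroup.finAdelic (Fp L) L (IsCMField.complexConj L) N' (Matrix.diagonal dV₁)) (hι : Function.Surjective ι) :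
    IsIrreducibleOrZero
      ((weilCoinv (Fp L) L (IsCMField.complexConj L) N' 1 e₁ (Matrix.diagonal dV₁) (JW (Fp L) L a) (complexConj_imagUnit L)
        (imagUnit_ne_zero L) (imagUnit_mul_self L) (realDiagonal_isSymm L dV₁ hdV₁) (isSymm_TW (Fp L) a)
        (isUnit_det_realDiagonal L dV₁ hdV₁ hdV₁0) (isUnit_det_TW (Fp L) a) (realDiagonal_map L dV₁ hdV₁).symm (JW_eq (Fp L) L a)
        χ'
        (isCompatible_chiSplittingLine L e₁ dV₁ hdV₁ hdV₁0 θ hθu hθs (TW (Fp L) a) (isSymm_TW (Fp L) a)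
          (isUnit_det_TW (Fp L) a) (JW (Fp L) L a) (JW_eq (Fp L) L a))).comp ι) :=
  (isIrreducibleOrZero_comp_iff_of_surjective _ ι hι).2
    (isIrreducibleOrZero_weilCoinv_chiSplittingLine_of_continuous L e₁ hn' dV₁ hdV₁ hdV₁0 θ hθu hθs a χ' hχ'n hχ'c)

end HeadGeneric

end Literature.NumberTheory.Automorphic.Liu2021.Def411WeilCarriers

end
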